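import Literature.NumberTheory.Transcendental.AnalytificationSecondCountableProofs
import Literature.AlgebraicGeometry.Motives.AlgPointsProperMapProofs
import Mathlib.AlgebraicGeometry.Morphisms.Finite
import Mathlib.AlgebraicGeometry.Morphisms.Proper
import Mathlib.AlgebraicGeometry.Morphisms.QuasiFinite
import Mathlib.AlgebraicGeometry.AffineSpace
import HarnessLib

/-!
# A finite projection of an affine `ℂ`-scheme to the line is proper with finite fibres on complex points

Layer `Literature/AlgebraicGeometry/FundamentalGroup`, an input of the curve case of Riemann's
existence theorem (SGA1 XII Thm. 5.1). Let `S` be an affine `ℂ`-scheme of finite type,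
`A = Γ(S, 𝒪_S)`, and `f ∈ A` such that `A` is module-finite over `ℂ[f]` (a Noether normalisation in
dimension `1`). Then the regular function `f : S(ℂ) → ℂ` on the complex points with the strong
topology is a PROPER map with FINITE fibres («`f` fini ⇒ `f^an` propre à fibres finies»,
SGA1 XII Prop. 3.2 (v)):

* `structureMap S : ℂ →+* Γ(S, 𝒪_S)` — the structure map, `eval_structureMap` (`c(P) = c`),
  `evalRingHom_comp_eval₂RingHom` (`p(f)(P) = p(f(P))`), `finiteType_structureMap`;
* `lineHom S f : S ⟶ 𝔸¹_ℂ` — the morphism defined by `f` (Mathlib's `AffineSpace.homOfVector`),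
  `eval_eq_affineCoords_map` — on complex points it is `f` followed by `𝔸¹(ℂ) = ℂ`;
* `isFinite_lineHom` — it is finite when `A` is finite over `ℂ[f]`
  (`HasAffineProperty.iff_of_isAffine` for `@IsFinite`);
* `isProperMap_eval` — **`f : S(ℂ) → ℂ` is proper** (the tree's `AlgPoints.isProperMap_map`,
  SGA1 XII 3.2 (v), and the homeomorphism `𝔸¹(ℂ) ≃ ℂ`);
* `finite_preimage_eval` — **its fibres are finite** (finite morphisms are quasi-finite,
  Mathlib's `Scheme.Hom.finite_preimage_singleton`, and complex points are determined by their
  underlying closed points).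

Everything is proved; the definitions are `structureMap` and `lineHom`.

## References

* A. Grothendieck, M. Raynaud, *SGA 1*, Exp. XII Prop. 3.2 (v), Thm. 5.1. [SGA1]
-/

noncomputable section

open scoped Topology Polynomial
open CategoryTheory AlgebraicGeometry Set Filter Function Polynomial
open Literature.AlgebraicGeometry.Motives
open Literature.AlgebraicGeometry.Motives.AlgPoints (evalOrZero evalOrZero_of_mem)
open Literature.NumberTheory.Transcendental

universe u

namespace Literature.AlgebraicGeometry.FundamentalGroup

namespace LineProjection

variable (S : SchemeOver ℂ)

/-! ### The structure map and evaluation -/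

/-- The structure map `ℂ → Γ(S, 𝒪_S)` of a `ℂ`-scheme. [folklore] -/
def structureMap : ℂ →+* Γ(S.left, ⊤) :=
  (S.hom.appLE ⊤ ⊤ le_top).hom.comp (Scheme.ΓSpecIso (.of ℂ)).inv.hom

/-- The structure map through `appTop`. [folklore] -/
theorem structureMap_eq_appTop : structureMap S = S.hom.appTop.hom.comp (Scheme.ΓSpecIso (.of ℂ)).inv.hom := by
  show (S.hom.appLE ⊤ (S.hom ⁻¹ᵁ ⊤) le_rfl).hom.comp _ = _
  rw [Scheme.Hom.appLE_eq_app]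
  rfl

/-- **Constants evaluate to themselves**: `c(P) = c` for `c ∈ ℂ ⊆ Γ(S, 𝒪_S)`. [folklore] -/
theorem eval_structureMap (P : ComplexPoints S) (c : ℂ) : P.eval ⊤ trivial (structureMap S c) = c := by
  simp only [structureMap, RingHom.coe_comp, comp_apply]
  rw [AlgPoints.eval_appLE_top (U := ⊤) P trivial le_top]
  simp only [Algebra.algebraMap_self, RingHom.id_apply]
  exact Iso.inv_hom_id_apply _ _

/-- Evaluation at a complex point is a retraction of the structure map. [folklore] -/
theorem evalRingHom_comp_structureMap (P : ComplexPoints S) :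
    (P.evalRingHom ⊤ trivial).comp (structureMap S) = RingHom.id ℂ :=
  RingHom.ext fun c ↦ by rw [RingHom.comp_apply, AlgPoints.evalRingHom_apply, eval_structureMap]; rfl

/-- Evaluating `p(f) ∈ Γ(S, 𝒪_S)` (`p ∈ ℂ[t]`) at a point is evaluating `p` at `f(P)`. [folklore] -/
theorem evalRingHom_comp_eval₂RingHom (P : ComplexPoints S) (f : Γ(S.left, ⊤)) :
    (P.evalRingHom ⊤ trivial).comp (eval₂RingHom (structureMap S) f) = evalRingHom (P.eval ⊤ trivial f) := by
  refine Polynomial.ringHom_ext (fun c ↦ ?_) ?_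
  · rw [RingHom.comp_apply, coe_eval₂RingHom, eval₂_C, coe_evalRingHom, eval_C, AlgPoints.evalRingHom_apply,
      eval_structureMap]
  · rw [RingHom.comp_apply, coe_eval₂RingHom, eval₂_X, coe_evalRingHom, eval_X, AlgPoints.evalRingHom_apply]

/-- **`Γ(S, 𝒪_S)` is a finitely generated `ℂ`-algebra** for `S` affine of finite type. [folklore] -/
theorem finiteType_structureMap [IsAffine S.left] [LocallyOfFiniteType S.hom] : (structureMap S).FiniteType := by
  have h1 : (S.hom.appLE ⊤ ⊤ le_top).hom.FiniteType :=
    S.hom.finiteType_appLE (isAffineOpen_top _) (isAffineOpen_top _) le_top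
  have h2 : (Scheme.ΓSpecIso (.of ℂ)).inv.hom.FiniteType :=
    RingHom.FiniteType.of_surjective _ (Scheme.ΓSpecIso (.of ℂ)).symm.commRingCatIsoToRingEquiv.surjective
  exact h1.comp h2

/-! ### The morphism to the line defined by a global function -/

/-- **The morphism `S → 𝔸¹_ℂ` defined by `f ∈ Γ(S, 𝒪_S)`** (Mathlib's `AffineSpace.homOfVector`), as
a morphism of `ℂ`-schemes. [folklore] -/
def lineHom (f : Γ(S.left, ⊤)) : S ⟶ affineSpaceOver (Fin 1) ℂ :=
  Over.homMk (AffineSpace.homOfVector S.hom (fun _ ↦ f)) (AffineSpace.homOfVector_over _ _)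

/-- The underlying morphism of schemes of `lineHom`. [folklore] -/
@[simp] theorem lineHom_left (f : Γ(S.left, ⊤)) : (lineHom S f).left = AffineSpace.homOfVector S.hom (fun _ ↦ f) := rfl

/-- `lineHom` pulls the coordinate back to `f`. [folklore] -/
theorem appTop_lineHom_coord (f : Γ(S.left, ⊤)) (i : Fin 1) :
    (lineHom S f).left.appTop (AffineSpace.coord (Spec (.of ℂ)) i) = f :=
  AffineSpace.homOfVector_appTop_coord _ _ _

/-- **On complex points `lineHom` is `f`**: the coordinate of the image point is `f(P)`. [folklore] -/
theorem affineCoords_map_lineHom (f : Γ(S.left, ⊤)) (P : ComplexPoints S) (i : Fin 1) :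
    AlgPoints.affineCoords (AlgPoints.map (lineHom S f) P) i = P.eval ⊤ trivial f := by
  rw [AlgPoints.affineCoords_apply, evalOrZero_of_mem _ (show (AlgPoints.map (lineHom S f) P).pt ∈ (⊤ : _) from trivial),
    AlgPoints.eval_map]
  show P.eval ⊤ trivial ((lineHom S f).left.appTop (AffineSpace.coord (Spec (.of ℂ)) i)) = _
  rw [appTop_lineHom_coord]

/-- `f : S(ℂ) → ℂ` factors as `lineHom(ℂ)` followed by `𝔸¹(ℂ) ≃ ℂ¹ → ℂ`. [folklore] -/
theorem eval_eq_comp_map_lineHom (f : Γ(S.left, ⊤)) :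
    (fun P : ComplexPoints S ↦ P.eval ⊤ trivial f) =
      (fun v : Fin 1 → ℂ ↦ v 0) ∘ (ComplexPoints.affineHomeomorph 1).symm ∘ AlgPoints.map (lineHom S f) := by
  funext P
  simp only [comp_apply, ComplexPoints.coe_affineHomeomorph_symm, affineCoords_map_lineHom]

/-! ### Finiteness, properness, finite fibres -/

/-- The structure map of `𝔸¹_ℂ` composed into `lineHom` is the structure map of `S`. [folklore] -/
theorem appTop_lineHom_comp_structureMap (f : Γ(S.left, ⊤)) :
    (lineHom S f).left.appTop.hom.comp (structureMap (affineSpaceOver (Fin 1) ℂ)) = structureMap S := by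
  rw [structureMap_eq_appTop, structureMap_eq_appTop, ← RingHom.comp_assoc, ← CommRingCat.hom_comp,
    ← Scheme.Hom.comp_appTop]
  congr 3
  exact Over.w (lineHom S f)

/-- `ℂ[t] → Γ(S, 𝒪_S)`, `t ↦ f`, factors through `Γ(𝔸¹, 𝒪) → Γ(S, 𝒪_S)`. [folklore] -/
theorem appTop_lineHom_comp_eval₂RingHom (f : Γ(S.left, ⊤)) :
    (lineHom S f).left.appTop.hom.comp
        (eval₂RingHom (structureMap (affineSpaceOver (Fin 1) ℂ)) (AffineSpace.coord (Spec (.of ℂ)) 0)) =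
      eval₂RingHom (structureMap S) f := by
  refine Polynomial.ringHom_ext (fun c ↦ ?_) ?_
  · rw [RingHom.comp_apply, coe_eval₂RingHom, eval₂_C, coe_eval₂RingHom, eval₂_C, ← RingHom.comp_apply,
      appTop_lineHom_comp_structureMap]
  · rw [RingHom.comp_apply, coe_eval₂RingHom, eval₂_X, coe_eval₂RingHom, eval₂_X]
    exact appTop_lineHom_coord S f 0

/-- **`lineHom` is a finite morphism** when `Γ(S, 𝒪_S)` is finite over `ℂ[f]` (and `S` is affine).
[cite: SGA1, Exp. XII Prop. 3.2 (v)] -/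
theorem isFinite_lineHom [IsAffine S.left] (f : Γ(S.left, ⊤)) (hfin : (eval₂RingHom (structureMap S) f).Finite) :
    IsFinite (lineHom S f).left := by
  haveI : IsAffine (affineSpaceOver (Fin 1) ℂ).left := inferInstanceAs (IsAffine 𝔸(Fin 1; Spec (.of ℂ)))
  rw [HasAffineProperty.iff_of_isAffine (P := @IsFinite)]
  refine ⟨inferInstance, ?_⟩
  rw [← appTop_lineHom_comp_eval₂RingHom] at hfin
  exact RingHom.Finite.of_comp_finite hfin

/-- **`f : S(ℂ) → ℂ` is proper** for `Γ(S, 𝒪_S)` finite over `ℂ[f]` («`f` propre ⇒ `f^an` propre»).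
[cite: SGA1, Exp. XII Prop. 3.2 (v)] -/
theorem isProperMap_eval [IsAffine S.left] (f : Γ(S.left, ⊤)) (hfin : (eval₂RingHom (structureMap S) f).Finite) :
    IsProperMap fun P : ComplexPoints S ↦ P.eval ⊤ trivial f := by
  haveI := isFinite_lineHom S f hfin
  rw [eval_eq_comp_map_lineHom]
  refine ((Homeomorph.funUnique (Fin 1) ℂ).isProperMap.comp (ComplexPoints.affineHomeomorph 1).symm.isProperMap).comp ?_
  exact AlgPoints.isProperMap_map (L := ℂ) (lineHom S f)

/-- **`f : S(ℂ) → ℂ` is continuous.** [folklore] -/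
theorem continuous_eval (f : Γ(S.left, ⊤)) : Continuous fun P : ComplexPoints S ↦ P.eval ⊤ trivial f := by
  have h := AlgPoints.continuous_evalOrZero_top (X := S) (L := ℂ) f
  refine h.congr fun P ↦ ?_
  exact evalOrZero_of_mem f trivial

/-- **The fibres of `f : S(ℂ) → ℂ` are finite** for `Γ(S, 𝒪_S)` finite over `ℂ[f]` and `S` of finite
type. [cite: SGA1, Exp. XII Prop. 3.2 (v)] -/
theorem finite_preimage_eval [IsAffine S.left] [LocallyOfFiniteType S.hom] (f : Γ(S.left, ⊤))
    (hfin : (eval₂RingHom (structureMap S) f).Finite) (z : ℂ) :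
    ((fun P : ComplexPoints S ↦ P.eval ⊤ trivial f) ⁻¹' {z}).Finite := by
  haveI := isFinite_lineHom S f hfin
  set Qz : ComplexPoints (affineSpaceOver (Fin 1) ℂ) := AlgPoints.affinePoint ℂ (fun _ ↦ z) with hQz
  -- the underlying points of the fibre lie in the (finite) fibre of the finite morphism `lineHom`
  have hfib : ((lineHom S f).left.base ⁻¹' {Qz.pt}).Finite := (lineHom S f).left.finite_preimage_singleton Qz.pt
  have hsub : (fun P : ComplexPoints S ↦ P.eval ⊤ trivial f) ⁻¹' {z} ⊆ (fun P : ComplexPoints S ↦ P.pt) ⁻¹' ((lineHom S f).left.base ⁻¹' {Qz.pt}) := by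
    intro P hP
    have hPz : P.eval ⊤ trivial f = z := hP
    have hmap : AlgPoints.map (lineHom S f) P = Qz := by
      rw [← AlgPoints.affinePoint_affineCoords (AlgPoints.map (lineHom S f) P), hQz]
      congr 1
      funext i
      rw [affineCoords_map_lineHom, hPz]
    show (lineHom S f).left.base P.pt ∈ ({Qz.pt} : Set _)
    rw [mem_singleton_iff, ← hmap]
    rfl
  -- and a complex point is determined by its underlying point
  have hinj : Function.Injective fun P : ComplexPoints S ↦ P.pt := by
    intro P Q h
    apply (ComplexPoints.equivClosedPoints S).injective
    exact Subtype.ext h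
  exact (hfib.preimage hinj.injOn).subset hsub

end LineProjection

end Literature.AlgebraicGeometry.FundamentalGroup
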